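import Literature.AnabelianGeometry.SemiGraphs.SgATemperedArrows
import Literature.AnabelianGeometry.SemiGraphs.TemperedFunctorialitySlimProofs
import Mathlib.Topology.Algebra.Group.Pointwise
import HarnessLib

/-!
# Isomorphisms over a base of profinite presentations: the constituent isomorphisms of
# topological groups (bridge B4, API; proof-only)

Mochizuki, *Semi-graphs of anabelioids*, Publ. RIMS **42** (2006), §3 p. 36 (profinite `Π_v`, `Π_e`)
and Def. 3.5 (i) p. 37 (kurims `paper:url-f33ace170ff4`). [cite: MochizukiSemiAnbd2006, Def 3.5(i) p.37]

PROOF-ONLY companion of B4-def `SgATemperedArrows.lean` (`ProfiniteSemiGraph.Hom.IsoOver`), written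
at the covering lineage's request (abc-iut-L3-d6 2026-08-26T11:47:21Z, remark (a): "`locTriv`
(bijective continuous homs of profinite groups) already yields homeomorphisms (compact → T2), so
consumers can extract `ContinuousMulEquiv`s"): the constituent groups of abc-iut-L3-t2's
`ProfiniteSemiGraph` are Hausdorff (totally disconnected topological groups), and an `IsoOver` —
indeed any locally trivial `Hom` — yields isomorphisms of TOPOLOGICAL groups
`X.Gv v ≃ₜ* Y.Gv (iso v)`, `X.Ge e ≃ₜ* Y.Ge (iso e)` (input for abc-iut-L3-d6's transport brick
`Thm37Hypotheses.of_isoOver`).  Nothing of the paper is asserted; no side taken on [IUTchIII] Cor. 3.12.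
-/

noncomputable section

namespace Literature.AnabelianGeometry.SemiGraphs

open CategoryTheory

universe u

namespace ProfiniteSemiGraph

variable {X Y P : ProfiniteSemiGraph.{u}}

/-- The edge groups of a profinite presentation are Hausdorff (companion of
`ProfiniteSemiGraph.t2Space_Gv`, abc-iut `TemperedFunctorialitySlimProofs.lean`: a totally
disconnected topological group has closed points). [cite: MochizukiSemiAnbd2006, Def. 2.1 p.23] -/
theorem t2Space_Ge (X : ProfiniteSemiGraph.{u}) (e : X.graph.Edge) : T2Space (X.Ge e) := by
  haveI : T1Space (X.Ge e) :=
    ⟨fun x => connectedComponent_eq_singleton x ▸ isClosed_connectedComponent⟩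
  infer_instance

/-- A bijective continuous homomorphism between constituent groups (compact source, Hausdorff
target) is an isomorphism of topological groups. [cite: MochizukiSemiAnbd2006, Def 2.2(ii) p.24] -/
theorem nonempty_continuousMulEquiv_of_bijective {A B : Type u} [Group A] [TopologicalSpace A]
    [CompactSpace A] [Group B] [TopologicalSpace B] [T2Space B] (h : A →ₜ* B)
    (hb : Function.Bijective h) :
    ∃ e : A ≃ₜ* B, ∀ x, e x = h x := by
  let e₀ : A ≃* B := MulEquiv.ofBijective h.toMonoidHom hb
  have he₀ : Continuous e₀ := h.continuous
  exact ⟨{ e₀ with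
      continuous_toFun := he₀
      continuous_invFun := Continuous.continuous_symm_of_equiv_compact_to_t2
        (f := e₀.toEquiv) he₀ }, fun _ => rfl⟩

/-- **A locally trivial morphism of profinite presentations gives isomorphisms of TOPOLOGICAL
groups on the vertex constituents** `X.Gv v ≃ₜ* Y.Gv (F v)`, agreeing with `F.hV v`.
[cite: MochizukiSemiAnbd2006, Def 2.2(ii) p.24] -/
theorem Hom.IsLocallyTrivial.exists_gvEquiv {F : Hom X Y} (hF : F.IsLocallyTrivial)
    (v : X.graph.Vertex) :
    ∃ e : X.Gv v ≃ₜ* Y.Gv (F.base.vertexMap v), ∀ x, e x = F.hV v x := by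
  haveI := t2Space_Gv (𝒢 := Y) (F.base.vertexMap v)
  exact nonempty_continuousMulEquiv_of_bijective (F.hV v) (hF.1 v)

/-- … and on the edge constituents `X.Ge e ≃ₜ* Y.Ge (F e)`. [cite: MochizukiSemiAnbd2006, Def 2.2(ii) p.24] -/
theorem Hom.IsLocallyTrivial.exists_geEquiv {F : Hom X Y} (hF : F.IsLocallyTrivial)
    (e : X.graph.Edge) :
    ∃ ε : X.Ge e ≃ₜ* Y.Ge (F.base.edgeMap e), ∀ x, ε x = F.hE e x := by
  haveI := t2Space_Ge Y (F.base.edgeMap e)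
  exact nonempty_continuousMulEquiv_of_bijective (F.hE e) (hF.2 e)

/-- **The constituent isomorphisms of topological groups of an isomorphism over `P`** (abc-iut-L3-d6's
remark (a)): `X.Gv v ≃ₜ* Y.Gv (iso v)` agreeing with `I.iso.hV v`.
[cite: MochizukiSemiAnbd2006, Def 3.5(i) p.37] -/
theorem Hom.IsoOver.exists_gvEquiv {p : Hom X P} {q : Hom Y P} (I : Hom.IsoOver p q)
    (v : X.graph.Vertex) :
    ∃ e : X.Gv v ≃ₜ* Y.Gv (I.iso.base.vertexMap v), ∀ x, e x = I.iso.hV v x :=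
  I.isLocallyTrivial.exists_gvEquiv v

/-- … and `X.Ge e ≃ₜ* Y.Ge (iso e)` agreeing with `I.iso.hE e`. [cite: MochizukiSemiAnbd2006, Def 3.5(i) p.37] -/
theorem Hom.IsoOver.exists_geEquiv {p : Hom X P} {q : Hom Y P} (I : Hom.IsoOver p q)
    (e : X.graph.Edge) :
    ∃ ε : X.Ge e ≃ₜ* Y.Ge (I.iso.base.edgeMap e), ∀ x, ε x = I.iso.hE e x :=
  I.isLocallyTrivial.exists_geEquiv e

/-- The vertex compatibility of an `IsoOver`, read with the topological-group isomorphism: up to an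
inner automorphism of `Π_{P, p v}`, `q ∘ e = p` on `Π_{X,v}`. [cite: MochizukiSemiAnbd2006, Def 3.5(i) p.37] -/
theorem Hom.IsoOver.exists_gvEquiv_comm {p : Hom X P} {q : Hom Y P} (I : Hom.IsoOver p q)
    (v : X.graph.Vertex) :
    ∃ (e : X.Gv v ≃ₜ* Y.Gv (I.iso.base.vertexMap v)) (g : P.Gv (p.base.vertexMap v)),
      ∀ x : X.Gv v,
        P.castGv (show q.base.vertexMap (I.iso.base.vertexMap v) = p.base.vertexMap v by
            rw [← I.base_comm]; rfl)
          (q.hV (I.iso.base.vertexMap v) (e x)) = g * p.hV v x * g⁻¹ := by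
  obtain ⟨e, he⟩ := I.exists_gvEquiv v
  obtain ⟨g, hg⟩ := I.hV_comm v
  exact ⟨e, g, fun x => by rw [he x]; exact hg x⟩

end ProfiniteSemiGraph

end Literature.AnabelianGeometry.SemiGraphs

end
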